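import Summits.ValiantsHypothesis.Statement
import Literature.Computability.AlgebraicComplexity.GCTObstructions
import Literature.Computability.AlgebraicComplexity.OrbitClosure

/-!
# ValiantsHypothesis / GCTMult — item `GctObstructionsToThesis` (stmt-ValiantsHypothesis-1048), closed

The support item bridging crux #2 of route `GCTMult` to its target: `GctMultObstructions → GctThesis`,
both spelled out by value — if, throughout the quasi-polynomial window
`n ≤ m ≤ 2^((log₂ n + c)^c)` (all large `n`, every `c`), some degree `d` carries a multiplicity
obstruction `HasMultiplicityObstruction (det_m) (X₀₀^{m-n} per_n) m d` (no `GL_{m²}`-equivariant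
linear surjection `ℂ[Δ(det_m)]_d ↠ ℂ[Δ(X₀₀^{m-n} per_n)]_d`), then throughout the same window
`X₀₀^{m-n} per_n ∉ Δ(det_m)`. The multiplicity-obstruction principle in its surjection-free form is
the tree theorem `Literature.Computability.AlgebraicComplexity.not_hasMultiplicityObstruction_of_mem_orbitClosure`
(`GCTObstructions.lean`; Mulmuley–Sohoni 2008; BLMW 2011 §2: membership `g ∈ Δ(f)` gives the
equivariant restriction surjection `ℂ[Δ f]_d ↠ ℂ[Δ g]_d` in every degree); this file contraposes it
inside the quantifier window. CONE HYGIENE (as the item asks): imports only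
`Summits.ValiantsHypothesis.Statement` and `Literature.Computability.AlgebraicComplexity.{GCTObstructions, OrbitClosure}`;
the signature is stated VERBATIM, so the route file is not imported. HONEST FRAMING: a bookkeeping
link of the chain crux → target → summit; the hypothesis (multiplicity obstructions in the window) is
OPEN and nothing here is progress on `VP ≠ VNP`.
-/

-- layout Summits/ValiantsHypothesis/ValiantsHypothesis forces the duplicated namespace component
set_option linter.dupNamespace false

namespace Summit.ValiantsHypothesis.ValiantsHypothesis.Theorems.GCTMult

open Literature.Computability.AlgebraicComplexity

/-- **Item `GctObstructionsToThesis` (stmt-ValiantsHypothesis-1048; `Theses.GCTMult.GctObstructionsToThesis`,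
signature verbatim): `GctMultObstructions → GctThesis`.** For each `c` take the `n₀` of the
hypothesis; at `(n, m)` in the window a degree `d` with a multiplicity obstruction is incompatible
with `X₀₀^{m-n} per_n ∈ Δ(det_m)` by `not_hasMultiplicityObstruction_of_mem_orbitClosure`
(Mulmuley–Sohoni 2008; BLMW 2011 §2). [cite: BLMW2011, §2] -/
theorem gctObstructionsToThesis_proof :
    (∀ c : ℕ, ∃ n₀ : ℕ, ∀ n ≥ n₀, ∀ (m : ℕ) [NeZero m], n ≤ m → m ≤ 2 ^ ((Nat.log 2 n + c) ^ c) →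
        ∃ d : ℕ, Literature.Computability.AlgebraicComplexity.HasMultiplicityObstruction
          (Literature.Computability.AlgebraicComplexity.detPoly (Fin m) ℂ)
          (Literature.Computability.AlgebraicComplexity.paddedPerPoly ℂ n m) m d) →
      ∀ c : ℕ, ∃ n₀ : ℕ, ∀ n ≥ n₀, ∀ (m : ℕ) [NeZero m], n ≤ m → m ≤ 2 ^ ((Nat.log 2 n + c) ^ c) →
        Literature.Computability.AlgebraicComplexity.paddedPerPoly ℂ n m ∉
          Literature.Computability.AlgebraicComplexity.orbitClosure
            (Literature.Computability.AlgebraicComplexity.detPoly (Fin m) ℂ) := by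
  intro h c
  obtain ⟨n₀, hn₀⟩ := h c
  refine ⟨n₀, fun n hn m _ hnm hmb hmem => ?_⟩
  obtain ⟨d, hd⟩ := hn₀ n hn m hnm hmb
  exact not_hasMultiplicityObstruction_of_mem_orbitClosure hmem d hd

end Summit.ValiantsHypothesis.ValiantsHypothesis.Theorems.GCTMult
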